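import Mathlib
import Summits.Ventures.DiscreteObjects.Mahler.TraceLiftMeasure
import Literature.NumberTheory.MahlerMeasure.MinimalMeasuresByDegree

/-!
# Kernel certificate of the degree-8 minimal measure `M₈ = 1.28063815…` (venture `DiscreteObjects`, target L)

Cell `pub-namedobj`, seat `pub-namedobj-mahler` (gen 10). Framing: lottery ticket; floor = certified
bounds/negative ranges.

A PRINT CONTROL in the kernel, via the generic Salem certificate `salem_traceLift_certificate`:
the Mossinghoff–Rhin–Wu Table-1 minimiser of degree 8, `x⁸ + x⁵ - x⁴ + x³ + 1`
(`Literature.NumberTheory.MahlerMeasure.mrwPoly8`, printed measure `1.28063816`, `ν = 1`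
[cite: MossinghoffRhinWu2008, Table 1 p.453]) is the reciprocal lift of `Q = y⁴ - 4y² + y + 1`, whose four
real roots lie in `(-2.06149886, -2.06149885)`, `(-1, 0)`, `(0, 1)`, `(1, 2)`; hence it is a Salem
polynomial with `M + M⁻¹ = |y₁|` and

  `1.28063815 < M(x⁸ + x⁵ - x⁴ + x³ + 1) < 1.28063816`.

* `traceLift_mrwTrace8` — `traceLift (X⁴ - 4X² + X + 1) = mrwPoly8`;
* `mrwPoly8_measure_enclosure` — the enclosure (agrees with the printed `1.28063816` to the last digit).
-/

namespace Summit.Ventures.DiscreteObjects.Mahler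

open Polynomial Literature.NumberTheory.MahlerMeasure

/-- The trace polynomial of the degree-8 minimiser: `x⁸ + x⁵ - x⁴ + x³ + 1 = x⁴ · Q(x + 1/x)` with
`Q = y⁴ - 4y² + y + 1`. -/
theorem traceLift_mrwTrace8 : traceLift (X ^ 4 - C 4 * X ^ 2 + X + 1 : ℤ[X]) = mrwPoly8 := by
  have hdeg : (X ^ 4 - C 4 * X ^ 2 + X + 1 : ℤ[X]).natDegree = 4 := by compute_degree!
  rw [traceLift, hdeg, mrwPoly8]
  simp only [Finset.sum_range_succ, Finset.sum_range_zero, zero_add, coeff_add, coeff_sub, coeff_X_pow,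
    coeff_C_mul, coeff_X, coeff_one]
  norm_num
  ring

/-- **`1.28063815 < M(x⁸ + x⁵ - x⁴ + x³ + 1) < 1.28063816`** (MRW Table 1, `D = 8`: `1.28063816`), and the
minimiser is a Salem polynomial: `M + M⁻¹` is the unique root of `y⁴ - 4y² + y + 1` below `-2`, negated. -/
theorem mrwPoly8_measure_enclosure :
    (128063815 / 10 ^ 8 : ℝ) < intMahlerMeasure mrwPoly8 ∧ intMahlerMeasure mrwPoly8 < 128063816 / 10 ^ 8 := by
  set Q : ℤ[X] := X ^ 4 - C 4 * X ^ 2 + X + 1 with hQdef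
  have hQmonic : Q.Monic := by rw [hQdef]; monicity!
  have hQdeg : Q.natDegree = 4 := by rw [hQdef]; compute_degree!
  -- the four real roots by sign changes
  set f : ℝ → ℝ := fun y => y ^ 4 - 4 * y ^ 2 + y + 1 with hf
  have hcont : Continuous f := by rw [hf]; fun_prop
  have hfQ : ∀ y : ℝ, aeval (y : ℂ) Q = ((f y : ℝ) : ℂ) := by
    intro y
    rw [hQdef, hf]
    simp only [map_add, map_sub, map_mul, map_pow, aeval_X, map_ofNat, map_one]
    push_cast; ring
  have root : ∀ a b : ℝ, a ≤ b → (f a < 0 ∧ 0 < f b) ∨ (f b < 0 ∧ 0 < f a) →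
      ∃ y, a < y ∧ y < b ∧ f y = 0 := by
    intro a b hab h
    rcases h with ⟨ha, hb⟩ | ⟨hb, ha⟩
    · obtain ⟨y, hy, hfy⟩ := intermediate_value_Ioo hab hcont.continuousOn ⟨ha, hb⟩
      exact ⟨y, hy.1, hy.2, hfy⟩
    · obtain ⟨y, hy, hfy⟩ := intermediate_value_Ioo' hab hcont.continuousOn ⟨hb, ha⟩
      exact ⟨y, hy.1, hy.2, hfy⟩
  set c₁ : ℝ := 128063815 / 10 ^ 8 with hc₁
  set c₂ : ℝ := 128063816 / 10 ^ 8 with hc₂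
  obtain ⟨y₁, h1a, h1b, h1f⟩ := root (-(c₂ + c₂⁻¹)) (-(c₁ + c₁⁻¹)) (by rw [hc₁, hc₂]; norm_num)
    (Or.inr ⟨by rw [hf, hc₁]; norm_num, by rw [hf, hc₂]; norm_num⟩)
  obtain ⟨y₂, h2a, h2b, h2f⟩ := root (-1) 0 (by norm_num) (Or.inl ⟨by rw [hf]; norm_num, by rw [hf]; norm_num⟩)
  obtain ⟨y₃, h3a, h3b, h3f⟩ := root 0 1 (by norm_num) (Or.inr ⟨by rw [hf]; norm_num, by rw [hf]; norm_num⟩)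
  obtain ⟨y₄, h4a, h4b, h4f⟩ := root 1 2 (by norm_num) (Or.inl ⟨by rw [hf]; norm_num, by rw [hf]; norm_num⟩)
  have hc1y : -(c₁ + c₁⁻¹) < -2 := by rw [hc₁]; norm_num
  have hy1 : y₁ < -2 := lt_trans h1b hc1y
  -- distinct roots
  set s : Multiset ℝ := {y₁, y₂, y₃, y₄} with hs
  have h12 : y₁ ≠ y₂ := ne_of_lt (by linarith)
  have h13 : y₁ ≠ y₃ := ne_of_lt (by linarith)
  have h14 : y₁ ≠ y₄ := ne_of_lt (by linarith)
  have h23 : y₂ ≠ y₃ := ne_of_lt (by linarith)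
  have h24 : y₂ ≠ y₄ := ne_of_lt (by linarith)
  have h34 : y₃ ≠ y₄ := ne_of_lt (by linarith)
  have hnodup : s.Nodup := by
    rw [hs]; simp [Multiset.insert_eq_cons, h12, h13, h14, h23, h24, h34]
  have hcard : Multiset.card s = Q.natDegree := by rw [hQdeg, hs]; simp
  have hroot : ∀ y ∈ s, aeval (y : ℂ) Q = 0 := by
    intro y hy
    rw [hfQ]
    rw [hs] at hy
    simp only [Multiset.insert_eq_cons, Multiset.mem_cons, Multiset.mem_singleton] at hy
    rcases hy with rfl | rfl | rfl | rfl
    · rw [h1f]; simp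
    · rw [h2f]; simp
    · rw [h3f]; simp
    · rw [h4f]; simp
  have hy₁ : y₁ ∈ s := by rw [hs]; simp
  have hbig : 2 < |y₁| := by rw [abs_of_neg (by linarith)]; linarith
  have hsmall : ∀ y ∈ s.erase y₁, |y| ≤ 2 := by
    intro y hy
    have hy' : y ∈ s ∧ y ≠ y₁ := ⟨Multiset.mem_of_mem_erase hy, ((Multiset.Nodup.mem_erase_iff hnodup).mp hy).1⟩
    rw [hs] at hy'
    simp only [Multiset.insert_eq_cons, Multiset.mem_cons, Multiset.mem_singleton] at hy'
    obtain ⟨hy'', hne⟩ := hy'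
    rcases hy'' with rfl | rfl | rfl | rfl
    · exact absurd rfl hne
    · rw [abs_le]; constructor <;> linarith
    · rw [abs_le]; constructor <;> linarith
    · rw [abs_le]; constructor <;> linarith
  obtain ⟨-, hM1, hMM⟩ := salem_traceLift_certificate hQmonic s hnodup hcard hroot hy₁ hbig hsmall
  rw [traceLift_mrwTrace8] at hM1 hMM
  rw [abs_of_neg (by linarith)] at hMM
  -- `c₁ + 1/c₁ < M + 1/M = -y₁ < c₂ + 1/c₂`
  have hMpos : 0 < intMahlerMeasure mrwPoly8 := by linarith
  constructor
  · -- `c₁ < M`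
    have h : c₁ + c₁⁻¹ < intMahlerMeasure mrwPoly8 + (intMahlerMeasure mrwPoly8)⁻¹ := by
      rw [hMM]; linarith
    exact lt_of_add_inv_lt_add_inv hM1.le (by rw [hc₁]; norm_num) h
  · have h : intMahlerMeasure mrwPoly8 + (intMahlerMeasure mrwPoly8)⁻¹ < c₂ + c₂⁻¹ := by
      rw [hMM]; linarith
    exact lt_of_add_inv_lt_add_inv (by rw [hc₂]; norm_num) hMpos h

end Summit.Ventures.DiscreteObjects.Mahler
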